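import Mathlib
import Literature.RingTheory.PBasis.EtaleOverPolynomialPBasis
import HarnessLib

/-!
# Cartier, step 0: on a smooth algebra over a perfect field, `dx = 0 ⇒ x` is a `p`-th power

Topic: `Literature/RingTheory/Smooth`.  Let `κ` be a perfect field of characteristic `p` and `R` a SMOOTH `κ`-algebra which is
reduced.  If the Kähler differential `d x ∈ Ω[R⁄κ]` of `x ∈ R` vanishes, then `x = y^p` for some `y ∈ R` — the degree-`0`
part of the Cartier isomorphism ([Katz1970Nilpotent] Thm. 7.2; [Illusie1979] 0.2): `ker (d : R → Ω¹) = R^p`.  Proof by charts: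
`R` is covered by basic opens `R[1/t]` which are standard smooth (Mathlib `Algebra.Smooth.exists_span_eq_top_isStandardSmooth`),
hence étale over a polynomial ring `κ[X₁,…,Xₙ]` (`RingHom.IsStandardSmooth.exists_etale_mvPolynomial`); there `d x = 0` forces
`x` to be a `p`-th power (`Literature.RingTheory.PBasis.exists_pow_eq_of_kaehlerDifferential_D_eq_zero_of_etale`, via the `p`-basis
given by the étale coordinates); the local `p`-th roots, cleared of denominators, are compatible by injectivity of Frobenius on the
reduced ring `R` and glue by a partition of unity.  The field case is `Literature.FieldTheory.Separability.
exists_pow_eq_of_kaehlerDifferential_D_eq_zero` (any separably generated extension of a perfect field).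
Theorems only; Mathlib + the tree's `PBasis` files.

References: N. Katz, *Nilpotent connections and the monodromy theorem*, Publ. Math. IHÉS 39 (1970), Thm. 7.2 [Katz1970Nilpotent];
L. Illusie, *Complexe de de Rham–Witt et cohomologie cristalline*, Ann. ÉNS 12 (1979), 0.(2.1)–(2.2) [Illusie1979]; H. Matsumura,
*Commutative Ring Theory*, §26 Thm. 26.5 [Matsumura1987].  Cell hodgecm-mathlib, E2 background («HO-alg», smooth-algebra form;
generic leaf, no floor change; HC_CM is proved only modulo the 7 printed citations until rung 0 closes).
-/

namespace Literature.RingTheory.Smooth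

open TensorProduct

universe u

variable (p : ℕ) [Fact p.Prime] {κ : Type u} [Field κ] [CharP κ p] [PerfectRing κ p]
variable {R : Type u} [CommRing R] [Algebra κ R]

/-- **Local step: on a standard smooth chart `d x = 0 ⇒ x` is a `p`-th power up to the chart's denominator.**  If `R[1/t]` is
standard smooth over the perfect field `κ` and `d x = 0` in `Ω[R⁄κ]`, then `a ^ p = x · (t^n)^p` for some `a ∈ R`, `n ∈ ℕ`
(étale coordinates on the chart, `exists_pow_eq_of_kaehlerDifferential_D_eq_zero_of_etale`, denominators cleared).
[cite: Katz1970Nilpotent, Thm. 7.2 (degree 0)] -/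
theorem exists_pow_eq_mul_pow_of_isStandardSmooth_away (t : R)
    (ht : Algebra.IsStandardSmooth κ (Localization.Away t)) (x : R) (hx : KaehlerDifferential.D κ R x = 0) :
    ∃ (a : R) (n : ℕ), a ^ p = x * (t ^ n) ^ p := by
  classical
  have hp : p.Prime := Fact.out
  set Rt := Localization.Away t with hRt
  -- the degenerate chart: `t` nilpotent
  by_cases htriv : Subsingleton Rt
  · have h0 : (0 : R) ∈ Submonoid.powers t := (IsLocalization.subsingleton_iff (S := Rt)).mp htriv
    obtain ⟨n, hn⟩ := h0
    have hn' : t ^ n = 0 := hn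
    exact ⟨0, n, by rw [hn', zero_pow hp.ne_zero, mul_zero]⟩
  rw [not_subsingleton_iff_nontrivial] at htriv
  haveI : CharP Rt p := charP_of_injective_ringHom (algebraMap κ Rt).injective p
  -- étale coordinates on the chart
  have hstd : (algebraMap κ Rt).IsStandardSmooth := RingHom.isStandardSmooth_algebraMap.mpr ht
  obtain ⟨n, g, hgC, hget⟩ := RingHom.IsStandardSmooth.exists_etale_mvPolynomial hstd
  letI : Algebra (MvPolynomial (Fin n) κ) Rt := g.toAlgebra
  haveI : IsScalarTower κ (MvPolynomial (Fin n) κ) Rt := IsScalarTower.of_algebraMap_eq' (by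
    rw [RingHom.algebraMap_toAlgebra, MvPolynomial.algebraMap_eq, hgC])
  haveI : Algebra.Etale (MvPolynomial (Fin n) κ) Rt := hget
  -- `d (x/1) = 0` on the chart, so `x/1` is a `p`-th power there
  have hx' : KaehlerDifferential.D κ Rt (algebraMap R Rt x) = 0 := by
    rw [← KaehlerDifferential.map_D κ κ R Rt x, hx, map_zero]
  obtain ⟨y, hy⟩ :=
    Literature.RingTheory.PBasis.exists_pow_eq_of_kaehlerDifferential_D_eq_zero_of_etale (κ := κ) (σ := Fin n) p Rt
      (algebraMap R Rt x) hx'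
  -- clear denominators: `y = a / t^k`, `t^m (a^p − x t^{kp}) = 0`
  obtain ⟨a, ⟨_, k, rfl⟩, rfl⟩ := IsLocalization.exists_mk'_eq (Submonoid.powers t) y
  rw [← IsLocalization.mk'_pow, IsLocalization.mk'_eq_iff_eq_mul, ← map_mul, IsLocalization.eq_iff_exists
    (Submonoid.powers t)] at hy
  obtain ⟨⟨_, m, rfl⟩, hm⟩ := hy
  simp only [SubmonoidClass.coe_pow] at hm
  change t ^ m * a ^ p = t ^ m * (x * (t ^ k) ^ p) at hm
  refine ⟨a * t ^ m, k + m, ?_⟩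
  have hp1 : m * p = m + m * (p - 1) := by
    have := hp.one_le
    zify [this]
    ring
  calc (a * t ^ m) ^ p = t ^ (m * (p - 1)) * (t ^ m * a ^ p) := by rw [mul_pow, ← pow_mul, hp1, pow_add]; ring
    _ = t ^ (m * (p - 1)) * (t ^ m * (x * (t ^ k) ^ p)) := by rw [hm]
    _ = x * (t ^ (k + m)) ^ p := by rw [← mul_assoc, ← pow_add, add_comm, ← hp1, pow_add, mul_pow, ← pow_mul t m p]; ring

/-- **Cartier, step 0, for smooth algebras over a perfect field: `ker d = R^p`.**  If `R` is a reduced smooth algebra over a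
perfect field `κ` of characteristic `p` and `x ∈ R` has `d x = 0` in `Ω[R⁄κ]`, then `x = y^p` for some `y ∈ R` (charts by
`exists_pow_eq_mul_pow_of_isStandardSmooth_away`, glued by injectivity of Frobenius and a partition of unity).
[cite: Katz1970Nilpotent, Thm. 7.2 (degree 0)] [cite: Matsumura1987, §26 Thm. 26.5] -/
theorem exists_pow_eq_of_kaehlerDifferential_D_eq_zero_of_smooth [Algebra.Smooth κ R] [IsReduced R] [CharP R p] (x : R)
    (hx : KaehlerDifferential.D κ R x = 0) : ∃ y : R, y ^ p = x := by
  classical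
  have hp : p.Prime := Fact.out
  obtain ⟨s, hs, hstd⟩ := Algebra.Smooth.exists_span_eq_top_isStandardSmooth κ R
  -- local `p`-th roots with cleared denominators: `a t ^ p = x * (u t) ^ p`, `u t = t ^ n t`
  choose a n han using fun t : s => exists_pow_eq_mul_pow_of_isStandardSmooth_away p t.1 (hstd t.1 t.2) x hx
  set u : s → R := fun t => t.1 ^ n t with hu
  -- compatibility on overlaps, by injectivity of Frobenius on the reduced ring `R`
  have hcompat : ∀ t t' : s, a t * u t' = a t' * u t := by
    intro t t'
    apply frobenius_inj R p
    rw [frobenius_def, frobenius_def, mul_pow, mul_pow, han t, han t']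
    ring
  -- partition of unity for the `u t`
  have hspan : Ideal.span (Set.range u) = ⊤ := Ideal.span_range_pow_eq_top s hs n
  obtain ⟨g, hg⟩ := (Finsupp.mem_span_range_iff_exists_finsupp (R := R) (v := u) (x := (1 : R))).mp
    ((Ideal.eq_top_iff_one _).mp hspan)
  simp only [smul_eq_mul] at hg
  set y : R := g.sum fun t c => c * a t with hy
  have hyu : ∀ t' : s, y * u t' = a t' := by
    intro t'
    rw [hy, Finsupp.sum_mul]
    calc (g.sum fun t c => c * a t * u t') = g.sum fun t c => a t' * (c * u t) := by
          refine Finsupp.sum_congr fun t _ => ?_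
          rw [mul_assoc, hcompat t t']
          ring
      _ = a t' * g.sum fun t c => c * u t := by rw [Finsupp.mul_sum]
      _ = a t' := by rw [hg, mul_one]
  -- `(y^p - x) · (u t)^p = 0` for every `t`, and the `(u t)^p` generate the unit ideal
  have hkill : ∀ t : s, (y ^ p - x) * u t ^ p = 0 := by
    intro t
    rw [sub_mul, ← mul_pow, hyu t, han t, sub_self]
  have hspan' : Ideal.span (Set.range fun t : s => u t ^ p) = ⊤ := by
    have := Ideal.span_range_pow_eq_top s hs fun t => n t * p
    simp_rw [pow_mul] at this
    exact this
  obtain ⟨h, hh⟩ :=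
    (Finsupp.mem_span_range_iff_exists_finsupp (R := R) (v := fun t : s => u t ^ p) (x := (1 : R))).mp
      ((Ideal.eq_top_iff_one _).mp hspan')
  simp only [smul_eq_mul] at hh
  refine ⟨y, sub_eq_zero.mp ?_⟩
  calc y ^ p - x = (y ^ p - x) * h.sum (fun t c => c * u t ^ p) := by rw [hh, mul_one]
    _ = h.sum (fun t c => c * ((y ^ p - x) * u t ^ p)) := by
        rw [Finsupp.mul_sum]
        exact Finsupp.sum_congr fun t _ => by ring
    _ = 0 := by
        rw [Finsupp.sum]
        exact Finset.sum_eq_zero fun t _ => by rw [hkill t, mul_zero]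

end Literature.RingTheory.Smooth
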